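import Literature.AlgebraicGeometry.AbelianSchemes.SerreCoverReturnIsogenyCofactor
import Literature.AlgebraicGeometry.AbelianSchemes.CoverSurjectiveOfSerrePresentation
import Literature.AlgebraicGeometry.AbelianSchemes.IsogenyOfFiniteKernelOnPoints
import Literature.AlgebraicGeometry.GroupSchemes.EtaleKernelDecidedOnPoints
import HarnessLib

/-!
# The homomorphism `u := q ≫ d_a` of an isogeny roof `A —q→ B ←c— A″` THROUGH THE RETURN HOM `d_a` OF THE COVER `c` (`c ≫ d_a = ι″(a)`):
# existence by descent, equivariance from common intertwiners, finiteness, and its kernel on `𝔟`-torsion points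
# ([MumfordAV1970] §7 Thm. 4 p. 72; [Liu2021] Prop. D.8 (2) p. 135; [Shimura1998] §13.1)

Topic `Literature/AlgebraicGeometry/AbelianSchemes`; namespace `Literature.AlgebraicGeometry.AbelianSchemes.AbelianSchemeOver`.  THEOREMS ONLY (no definition,
no named fact, no `instance`, no notation, no `sorry`); `Ω = Ω̄` of characteristic `0`.  Cell `hodgecm-mathlib` (D-0151), F0∕P6 «MOD» (crux hLiu418 =
stmt-HodgeConjecture-24832, `--supports`, count-neutral), line L2, organ (ρ1) «REDUCED ROOF HOM» of `stub_SPGEOM`'s `RedHomLaw` road, UPSTAIRS half in the shape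
(T𝒜) of LA2-plan (g0)'s ruling «ρ-ROAD v2» (2026-09-02T05:36:25Z): the roof `A_y —q→ B ←c— A_{y″}` of the moduli datum (`RoofΩ` (r1)(r2)(r4)) is turned into ONE
homomorphism `u := q ≫ d_a : A_y → A_{y″}` INTO THE FIBRE OF THE SAME FAMILY, where `d_a : B → A_{y″}` is the return hom of the cover `c` at a scalar `a ∈ 𝔞`
(`c ≫ d_a = ι″(a)`) — NEVER the `N`-return `d_N` (which kills whole layers).  HC_CM is proved only modulo the cell's 2 remaining named inputs (hLiu418 24832,
h413 24833) until rung 0 closes; this file is generic and changes no count.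

THE MATHEMATICS.  `A`, `A″`, `B` abelian schemes over `Spec Ω`, `ι`, `ι″` actions of a commutative ring `𝒪` on `A`, `A″`; `q : A → B`, `c : A″ → B` homomorphisms,
`c` finite surjective; `𝔞 ⊆ 𝒪`, `a ∈ 𝒪` with `Ker c(Ω) ⊆ Ker ι″(a)(Ω)` (e.g. `Ker c(Ω) = A″[𝔞](Ω)` and `a ∈ 𝔞`).  (§1) Kernels of isogenies in characteristic `0`
are decided on `Ω`-points (★ `comp_eq_one_of_forall_algPoints_of_charZero`), so `ι″(a)` descends through the fppf cover `c` (★ `existsUnique_comp_eq_of_forall_comp_eq_one`):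
`c ≫ d = ι″(a)` for a unique `d`, a homomorphism (★ `isMonHom_of_cover_comp_eq`).  (§2) If every `ι(x)`, `ι″(x)` has a COMMON INTERTWINER `b_x` on `B` (`ι(x) ≫ q =
q ≫ b_x`, `ι″(x) ≫ c = c ≫ b_x` — `RoofΩ` (r4)), then `b_x ≫ d = d ≫ ι″(x)` (both descend `ι″(a) ≫ ι″(x) = ι″(xa)` through `c`), hence `u := q ≫ d` is
`𝒪`-EQUIVARIANT: `ι(x) ≫ u = u ≫ ι″(x)`.  (§3) `u` kills `Ker q`; and on `𝔟`-TORSION POINTS `u` has THE SAME KERNEL AS `q` as soon as `𝔞 ⊆ (a) + 𝔞𝔟` (for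
`𝔞 = 𝔭_w`, `𝔟 = 𝔭_{c•w}` and `a ∈ 𝔭_w ∖ 𝔭_{c•w}`: `(a) + 𝔭_w𝔭_{c•w} = 𝔭_w`): if `𝔟·P = 1` and `u(P) = 1`, write `q(P) = c(P″)`; then `ι″(a)P″ = d(c(P″)) = 1` and, for
`x ∈ 𝔟`, `c(ι″(x)P″) = b_x(q(P)) = q(ι(x)P) = 1`, so `ι″(x)P″ ∈ Ker c(Ω) = A″[𝔞](Ω)`: the annihilator of `P″` contains `(a) + 𝔞𝔟 ⊇ 𝔞`, so `P″ ∈ Ker c(Ω)` and `q(P) = 1`.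
(§4) If `a·a′ = N ≠ 0` then `ι″(a)` is surjective (★ `surjective_left_of_comp_eq_i_natCast`), so `d` and `u` are surjective; a kernel point `P` of `u` has `q(P)^N = 1`
(`q(P) = c(P″)`, `a·P″ = 1 ⇒ N·P″ = 1`), so with `Ker q(Ω)` finite `Ker u(Ω)` is finite (★ `finite_setOf_map_eq_one_of_pow_eq_one`), and the surjective `u` with finite
`Ker u(Ω)` is FINITE (★ `roof_legs_isFinite_surjective_of_isOfRelDim` at the roof `(u, u)`).

* §1 **`exists_isMonHom_cover_comp_eq_of_forall_algPoints`** (`∃ d, IsMonHom d ∧ c ≫ d = ι″(a)`);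
* §2 `intertwiner_comp_eq_comp_i_of_cover_comp_eq`, **`i_comp_comp_eq_comp_comp_i_of_common_intertwiner`** (equivariance of `q ≫ d`);
* §3 `comp_comp_eq_one_of_comp_eq_one`, **`comp_eq_one_of_comp_comp_eq_one_of_forall_mem`** (same kernel on `𝔟`-torsion points);
* §4 `surjective_i_left_of_mul_eq_natCast`, `pow_eq_one_of_comp_comp_eq_one`, **`surjective_comp_and_isFinite_comp_of_isOfRelDim`**.

## References
* [MumfordAV1970] D. Mumford, *Abelian Varieties* (1970), §7 Thm. 4 (p. 72), §19 Thm. 1 (p. 174), §6 Application 3 (pp. 62–64).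
* [Liu2021] Y. Liu, *Fourier–Jacobi cycles and arithmetic relative trace formula*, Camb. J. Math. 9 (2021), App. D, Prop. D.8 (2) (p. 135), p. 137.
* [Shimura1998] G. Shimura, *Abelian Varieties with Complex Multiplication and Modular Functions* (1998), §13.1 Theorem 1 (pp. 97–99).
* [GortzWedhorn2020] U. Görtz, T. Wedhorn, *Algebraic Geometry I*, 2nd ed. (2020), Definition 4.45 (2) (p. 117), Cor. 3.36 (p. 83).
-/

set_option autoImplicit false

noncomputable section

set_option backward.isDefEq.respectTransparency false

universe u

open CategoryTheory CategoryTheory.Limits AlgebraicGeometry MonoidalCategory CartesianMonoidalCategory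
open scoped MonObj

namespace Literature.AlgebraicGeometry.AbelianSchemes

namespace AbelianSchemeOver

open Literature.AlgebraicGeometry.Motives (AlgPoints SchemeOver specOver)

variable {Ω : Type u} [Field Ω] {A A'' B : AbelianSchemeOver (Spec (.of Ω))} {O : Type*} [CommRing O]
  (ρ : A.RingAction O) (ρ'' : A''.RingAction O) (q : A.X ⟶ B.X) (c : A''.X ⟶ B.X) [IsMonHom c]

/-! ## §1 The return hom `d` of the cover `c` at a scalar `a`: `c ≫ d = ι″(a)` -/

/-- **THE RETURN HOM OF THE COVER AT `a`** (`Ω = Ω̄`, characteristic `0`; `c` finite surjective; `Ker c(Ω) ⊆ Ker ι″(a)(Ω)`): there is a homomorphism `d : B → A″` with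
`c ≫ d = ι″(a)` (kernel inclusion decided on `Ω`-points ★ `comp_eq_one_of_forall_algPoints_of_charZero`, descent through the fppf cover `c` ★
`existsUnique_comp_eq_of_forall_comp_eq_one`, ★ `isMonHom_of_cover_comp_eq`). [cite: MumfordAV1970, §7 Thm. 4 (p. 72)] [cite: GortzWedhorn2020, Definition 4.45 (2) (p. 117)] -/
theorem exists_isMonHom_cover_comp_eq_of_forall_algPoints [IsAlgClosed Ω] [CharZero Ω] [IsFinite c.left] [Surjective c.left] (a : O)
    (hkc : ∀ P : specOver Ω Ω ⟶ A''.X, P ≫ c = 1 → P ≫ ρ''.i a = 1) :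
    ∃ d : B.X ⟶ A''.X, IsMonHom d ∧ c ≫ d = ρ''.i a := by
  haveI := ρ''.isMonHom a
  haveI : Flat c.left := flat_left_of_isFinite_of_surjective c
  have hker : ∀ ⦃T : Over (Spec (.of Ω))⦄ (t : T ⟶ A''.X), t ≫ c = 1 → t ≫ ρ''.i a = 1 := fun T t ht =>
    comp_eq_one_of_forall_algPoints_of_charZero c (ρ''.i a) hkc t ht
  obtain ⟨d, hd, -⟩ := A''.existsUnique_comp_eq_of_forall_comp_eq_one c (ρ''.i a) hker
  exact ⟨d, isMonHom_of_cover_comp_eq ρ'' c d a hd, hd⟩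

/-! ## §2 Equivariance of `q ≫ d` from common intertwiners -/

/-- **A COMMON INTERTWINER COMMUTES WITH THE RETURN HOM**: if `ι″(x) ≫ c = c ≫ b` then `b ≫ d = d ≫ ι″(x)` — both are the descent through `c` of
`ι″(a) ≫ ι″(x) = ι″(x) ≫ ι″(a)` (uniqueness in ★ `existsUnique_comp_eq_of_forall_comp_eq_one`). [cite: MumfordAV1970, §7 Thm. 4 (p. 72)] -/
theorem intertwiner_comp_eq_comp_i_of_cover_comp_eq [IsAlgClosed Ω] [CharZero Ω] [IsFinite c.left] [Surjective c.left]
    (d : B.X ⟶ A''.X) (a : O) (hcd : c ≫ d = ρ''.i a) (hkc : ∀ P : specOver Ω Ω ⟶ A''.X, P ≫ c = 1 → P ≫ ρ''.i a = 1)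
    (x : O) (b : B.X ⟶ B.X) (hb : ρ''.i x ≫ c = c ≫ b) : b ≫ d = d ≫ ρ''.i x := by
  haveI := ρ''.isMonHom
  haveI : IsMonHom d := isMonHom_of_cover_comp_eq ρ'' c d a hcd
  haveI : Flat c.left := flat_left_of_isFinite_of_surjective c
  have hker : ∀ ⦃T : Over (Spec (.of Ω))⦄ (t : T ⟶ A''.X), t ≫ c = 1 → t ≫ (ρ''.i a ≫ ρ''.i x) = 1 := fun T t ht => by
    rw [← Category.assoc, comp_eq_one_of_forall_algPoints_of_charZero c (ρ''.i a) hkc t ht, MonObj.one_comp]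
  obtain ⟨χ, -, huniq⟩ := A''.existsUnique_comp_eq_of_forall_comp_eq_one c (ρ''.i a ≫ ρ''.i x) hker
  have h1 : c ≫ (b ≫ d) = ρ''.i a ≫ ρ''.i x := by
    rw [← Category.assoc, ← hb, Category.assoc, hcd, ← ρ''.i_mul, ← ρ''.i_mul, mul_comm]
  have h2 : c ≫ (d ≫ ρ''.i x) = ρ''.i a ≫ ρ''.i x := by rw [← Category.assoc, hcd]
  rw [huniq _ h1, huniq _ h2]

/-- **`u := q ≫ d` IS `𝒪`-EQUIVARIANT** when every `x ∈ 𝒪` has a common intertwiner on `B` (`ι(x) ≫ q = q ≫ b_x`, `ι″(x) ≫ c = c ≫ b_x` — `RoofΩ` (r4)):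
`ι(x) ≫ u = u ≫ ι″(x)`. [cite: MumfordAV1970, §7 Thm. 4 (p. 72)] [cite: Liu2021, Prop. D.8 (2) p. 135] -/
theorem i_comp_comp_eq_comp_comp_i_of_common_intertwiner [IsAlgClosed Ω] [CharZero Ω] [IsFinite c.left] [Surjective c.left]
    (d : B.X ⟶ A''.X) (a : O) (hcd : c ≫ d = ρ''.i a) (hkc : ∀ P : specOver Ω Ω ⟶ A''.X, P ≫ c = 1 → P ≫ ρ''.i a = 1)
    (hb : ∀ x, ∃ b : B.X ⟶ B.X, ρ.i x ≫ q = q ≫ b ∧ ρ''.i x ≫ c = c ≫ b) (x : O) :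
    ρ.i x ≫ (q ≫ d) = (q ≫ d) ≫ ρ''.i x := by
  obtain ⟨b, hq, hc⟩ := hb x
  rw [← Category.assoc, hq, Category.assoc, intertwiner_comp_eq_comp_i_of_cover_comp_eq ρ'' c d a hcd hkc x b hc, Category.assoc]

/-! ## §3 The kernel of `q ≫ d`: it contains `Ker q`, and agrees with it on `𝔟`-torsion points when `𝔞 ⊆ (a) + 𝔞𝔟` -/

omit [IsMonHom c] in
/-- `u = q ≫ d` kills every `T`-point killed by `q`. [cite: Liu2021, Prop. D.8 (2) p. 135] -/
theorem comp_comp_eq_one_of_comp_eq_one (d : B.X ⟶ A''.X) [IsMonHom d] {T : Over (Spec (.of Ω))} (t : T ⟶ A.X) (ht : t ≫ q = 1) :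
    t ≫ (q ≫ d) = 1 := by
  rw [← Category.assoc, ht, MonObj.one_comp]

omit [IsMonHom c] in
/-- **ON `𝔟`-TORSION POINTS `u = q ≫ d` HAS THE KERNEL OF `q`** (`Ω = Ω̄`; `c` finite surjective with `Ker c(Ω) ⊆ A″[𝔞](Ω)`; common intertwiners for the `x ∈ 𝔟`;
`𝔞 ⊆ (a) + 𝔞·𝔟`): an `Ω`-point `P` of `A` with `ι(x)P = 1` for all `x ∈ 𝔟` and `u(P) = 1` has `q(P) = 1`.  (For `𝔞 = 𝔭_w`, `𝔟 = 𝔭_{c•w}`, `a ∈ 𝔭_w ∖ 𝔭_{c•w}`: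
`Ker u ∩ A[𝔭_{c•w}] = Ker q ∩ A[𝔭_{c•w}] = L` on `Ω̄`-points.) [cite: Liu2021, Prop. D.8 (2) p. 135, p. 137] [cite: Shimura1998, §13.1, Theorem 1 (pp. 97–99)] -/
theorem comp_eq_one_of_comp_comp_eq_one_of_forall_mem [IsAlgClosed Ω] [IsFinite c.left] [Surjective c.left] [IsMonHom q]
    (d : B.X ⟶ A''.X) (a : O) (hcd : c ≫ d = ρ''.i a) (𝔞 𝔟 : Ideal O)
    (hkc : ∀ P : specOver Ω Ω ⟶ A''.X, P ≫ c = 1 ↔ ∀ a' ∈ 𝔞, P ≫ ρ''.i a' = 1)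
    (hb : ∀ x ∈ 𝔟, ∃ b : B.X ⟶ B.X, ρ.i x ≫ q = q ≫ b ∧ ρ''.i x ≫ c = c ≫ b)
    (h𝔞 : 𝔞 ≤ Ideal.span {a} ⊔ 𝔞 * 𝔟)
    (P : specOver Ω Ω ⟶ A.X) (hP𝔟 : ∀ x ∈ 𝔟, P ≫ ρ.i x = 1) (hPu : P ≫ (q ≫ d) = 1) : P ≫ q = 1 := by
  haveI := ρ.isMonHom
  haveI := ρ''.isMonHom
  -- `q(P) = c(P″)`
  obtain ⟨P'', hP''⟩ := Literature.AlgebraicGeometry.Morphisms.exists_over_comp_eq_of_surjective c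
    (Spec.map (CommRingCat.ofHom (algebraMap Ω Ω))) (P ≫ q)
  -- the annihilator of `P″` is an ideal containing `a` and `𝔞·𝔟`
  let Ann : Ideal O :=
    { carrier := {s | P'' ≫ ρ''.i s = 1}
      add_mem' := fun {s t} hs ht => by
        change P'' ≫ ρ''.i (s + t) = 1
        rw [ρ''.i_add, MonObj.comp_mul, hs, ht, mul_one]
      zero_mem' := by
        change P'' ≫ ρ''.i 0 = 1
        rw [ρ''.i_zero, MonObj.comp_one]
      smul_mem' := fun r {s} hs => by
        change P'' ≫ ρ''.i (r * s) = 1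
        rw [ρ''.i_mul, ← Category.assoc, hs, MonObj.one_comp] }
  have ha : a ∈ Ann := by
    change P'' ≫ ρ''.i a = 1
    rw [← hcd, ← Category.assoc, hP'', Category.assoc, hPu]
  have h𝔞𝔟 : 𝔞 * 𝔟 ≤ Ann := by
    rw [Ideal.mul_le]
    intro a' ha' x hx
    change P'' ≫ ρ''.i (a' * x) = 1
    obtain ⟨b, hqb, hcb⟩ := hb x hx
    -- `ι″(x)P″ ∈ Ker c(Ω) = A″[𝔞](Ω)`
    have hx' : (P'' ≫ ρ''.i x) ≫ c = 1 := by
      rw [Category.assoc, hcb, ← Category.assoc, hP'', Category.assoc, ← hqb, ← Category.assoc, hP𝔟 x hx, MonObj.one_comp]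
    rw [ρ''.i_mul, ← Category.assoc]
    exact (hkc _).1 hx' a' ha'
  have hle : 𝔞 ≤ Ann := h𝔞.trans (sup_le ((Ideal.span_singleton_le_iff_mem _).2 ha) h𝔞𝔟)
  -- so `P″ ∈ Ker c(Ω)` and `q(P) = c(P″) = 1`
  have hP''c : P'' ≫ c = 1 := (hkc P'').2 fun a' ha' => hle ha'
  rw [← hP'', hP''c]

/-! ## §4 Surjectivity and finiteness of `q ≫ d` -/

omit [IsMonHom c] in
/-- `ι″(a)` is surjective when `a·a′ = N ≠ 0` (`ι″(a′) ≫ ι″(a) = ι″(N) = [N]`, ★ `surjective_left_of_comp_eq_i_natCast`). [cite: MumfordAV1970, §6 Application 3 (pp. 62–64)] -/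
theorem surjective_i_left_of_mul_eq_natCast (a a' : O) {N : ℕ} (hN : N ≠ 0) (h : a * a' = N) : Surjective (ρ''.i a).left :=
  surjective_left_of_comp_eq_i_natCast ρ'' (ρ''.i a) (ρ''.i a') hN (by rw [← ρ''.i_mul, h])

/-- A kernel point of `u = q ≫ d` has `q(P)^N = 1` when `c ≫ d = ι″(a)` and `a·a′ = N` (`q(P) = c(P″)` with `ι″(a)P″ = 1`). [cite: MumfordAV1970, §7 Thm. 4 (p. 72)] -/
theorem pow_eq_one_of_comp_comp_eq_one [IsAlgClosed Ω] [IsFinite c.left] [Surjective c.left]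
    (d : B.X ⟶ A''.X) (a a' : O) {N : ℕ} (h : a * a' = N) (hcd : c ≫ d = ρ''.i a)
    (P : specOver Ω Ω ⟶ A.X) (hPu : P ≫ (q ≫ d) = 1) : (P ≫ q) ^ N = 1 := by
  haveI := ρ''.isMonHom
  obtain ⟨P'', hP''⟩ := Literature.AlgebraicGeometry.Morphisms.exists_over_comp_eq_of_surjective c
    (Spec.map (CommRingCat.ofHom (algebraMap Ω Ω))) (P ≫ q)
  have ha : P'' ≫ ρ''.i a = 1 := by rw [← hcd, ← Category.assoc, hP'', Category.assoc, hPu]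
  have hN' : P'' ≫ ρ''.i (N : O) = 1 := by
    rw [← h, mul_comm, ρ''.i_mul, ← Category.assoc, ha, MonObj.one_comp]
  have hi : ∀ n : ℕ, ρ''.i (n : O) = (𝟙 A''.X) ^ n := fun n => by
    induction n with
    | zero => rw [Nat.cast_zero, ρ''.i_zero]; exact (_root_.pow_zero _).symm
    | succ n ih => rw [Nat.cast_succ, ρ''.i_add, ih, ρ''.i_one]; exact (_root_.pow_succ _ _).symm
  rw [hi, MonObj.comp_pow, Category.comp_id] at hN'
  rw [← hP'', ← MonObj.pow_comp, hN', MonObj.one_comp]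

/-- **`u = q ≫ d` IS FINITE AND SURJECTIVE** (`Ω = Ω̄`; `A` of some relative dimension `g`; `q` surjective with `Ker q(Ω)` finite; `c ≫ d = ι″(a)`,
`a·a′ = N ≠ 0`): `d` is surjective (★ `surjective_left_of_cover_comp_eq`), `Ker u(Ω)` lies in the `(N·#Ker q(Ω))`-torsion-like finite set, and ★
`roof_legs_isFinite_surjective_of_isOfRelDim` applies to the roof `(u, u)`. [cite: MumfordAV1970, §19 Thm. 1 (proof, p. 174), §6 Application 3 (pp. 62–64)] -/
theorem surjective_comp_and_isFinite_comp_of_isOfRelDim [IsAlgClosed Ω] [IsFinite c.left] [Surjective c.left] [IsMonHom q] [Surjective q.left]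
    {g : ℕ} (hA : A.IsOfRelDim g)
    (d : B.X ⟶ A''.X) (a a' : O) {N : ℕ} (hN : N ≠ 0) (h : a * a' = N) (hcd : c ≫ d = ρ''.i a)
    (hKq : {P : A.toAffine.toAbelianVariety.Points Ω | (AlgPoints.map q P : B.toAffine.toAbelianVariety.Points Ω) = 1}.Finite) :
    Surjective (q ≫ d).left ∧ IsFinite (q ≫ d).left := by
  haveI := ρ''.isMonHom
  haveI : IsMonHom d := isMonHom_of_cover_comp_eq ρ'' c d a hcd
  haveI : Surjective (ρ''.i a).left := surjective_i_left_of_mul_eq_natCast ρ'' a a' hN h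
  haveI : Surjective d.left := surjective_left_of_cover_comp_eq ρ'' c d a hcd
  have hsurj : Function.Surjective (q ≫ d).left.base := by
    rw [Over.comp_left, Scheme.Hom.comp_base]
    exact (inferInstance : Surjective d.left).surj.comp (inferInstance : Surjective q.left).surj
  -- the kernel points of `q` form a finite subgroup of order `m`
  let Λ : (A.toAffine.toAbelianVariety.Points Ω) →* (B.toAffine.toAbelianVariety.Points Ω) :=
    { toFun := fun P => P ≫ q
      map_one' := MonObj.one_comp _
      map_mul' := fun x y => MonObj.mul_comp x y _ }
  have hKfin : (Λ.ker : Set (A.toAffine.toAbelianVariety.Points Ω)).Finite := hKq.subset fun P hP => hP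
  haveI : Finite Λ.ker := hKfin.to_subtype
  have hm : 0 < Nat.card Λ.ker := Nat.card_pos
  have hfin : {P : A.toAffine.toAbelianVariety.Points Ω |
      (AlgPoints.map (q ≫ d) P : A''.toAffine.toAbelianVariety.Points Ω) = 1}.Finite := by
    refine finite_setOf_map_eq_one_of_pow_eq_one (q ≫ d) (N * Nat.card Λ.ker) (Nat.mul_ne_zero hN hm.ne') fun P hP => ?_
    have hPN : P ^ N ∈ Λ.ker := by
      rw [MonoidHom.mem_ker, map_pow]
      exact pow_eq_one_of_comp_comp_eq_one ρ'' q c d a a' h hcd P hP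
    have hcard : (⟨P ^ N, hPN⟩ : Λ.ker) ^ Nat.card Λ.ker = 1 := pow_card_eq_one'
    rw [pow_mul]
    exact congrArg Subtype.val hcard
  have H := roof_legs_isFinite_surjective_of_isOfRelDim hA hA (q ≫ d) (q ≫ d) hsurj hfin hfin
  exact ⟨H.1, H.2.1⟩

end AbelianSchemeOver

end Literature.AlgebraicGeometry.AbelianSchemes

end
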